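import Mathlib
import Summits.Ventures.DiscreteObjects.Mahler.SmythTheorem

/-!
# Siegel's theorem: every Pisot number is `≥ θ₀ = 1.3247…` (venture `DiscreteObjects`, target L)

Cell `pub-namedobj`, seat `pub-namedobj-mahler` (gen 8). Framing: lottery ticket; floor = certified
bounds/negative ranges.

[McKee–Smyth, *Around the Unit Circle*, §12.3 ("Theorem 12.1 … generalises Siegel's result [Sie44] that
`z³ - z - 1` is the minimal polynomial of the smallest Pisot number"); Siegel 1944.]

A **Pisot number** is a real algebraic integer `θ > 1` all of whose other conjugates lie in the open unit
disc.  We phrase it on the minimal polynomial: `P ∈ ℤ[X]` monic irreducible, `θ > 1` a root of `P` over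
`ℂ`, and every other complex root of `P` has modulus `< 1`.  Then:

* `intMahlerMeasure_eq_of_pisot` — `M(P) = θ`;
* `smythTheta_le_of_pisot` — **Siegel's lower bound** `θ ≥ θ₀` (`θ₀ = 1.3247…` the real root of
  `z³ = z + 1`): for `deg P ≥ 3` the Pisot condition forces `P` nonreciprocal, so Smyth's theorem
  (`SmythTheorem.intMahlerMeasure_ge_smythTheta_of_nonreciprocal`) applies; quadratic and linear Pisot
  numbers are `≥ (1+√5)/2` resp. `≥ 2` by a direct argument.
-/

namespace Summit.Ventures.DiscreteObjects.Mahler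

open Polynomial

/-- An irreducible `P ∈ ℤ[X]` with `P(0) = 0` is `± X`, so has degree `1`. -/
theorem natDegree_eq_one_of_irreducible_coeff_zero {P : ℤ[X]} (hirr : Irreducible P) (h0 : P.coeff 0 = 0) :
    P.natDegree = 1 := by
  have hdvd : (X : ℤ[X]) ∣ P := X_dvd_iff.mpr h0
  have hass : Associated X P := irreducible_X.associated_of_dvd hirr hdvd
  obtain ⟨u, hu⟩ := hass
  obtain ⟨c, hc, hcu⟩ := Polynomial.isUnit_iff.mp u.isUnit
  rw [← hu, ← hcu, natDegree_mul_C hc.ne_zero, natDegree_X]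

/-- The complex roots of an irreducible integer polynomial are simple. -/
theorem nodup_roots_of_irreducible {P : ℤ[X]} (hirr : Irreducible P) (hdeg : 0 < P.natDegree) :
    (P.map (Int.castRingHom ℂ)).roots.Nodup := by
  have hPQ : Irreducible (P.map (algebraMap ℤ ℚ)) :=
    ((hirr.isPrimitive hdeg.ne').irreducible_iff_irreducible_map_fraction_map (K := ℚ)).mp hirr
  have hsep : (P.map (algebraMap ℤ ℚ)).Separable := hPQ.separable
  have hmap : P.map (Int.castRingHom ℂ) = (P.map (algebraMap ℤ ℚ)).map (algebraMap ℚ ℂ) := by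
    have hφ : (algebraMap ℚ ℂ).comp (algebraMap ℤ ℚ) = Int.castRingHom ℂ := RingHom.ext_int _ _
    rw [Polynomial.map_map, hφ]
  rw [hmap]
  exact nodup_roots hsep.map

/-- If `α ≠ 0` is a complex root of `P ∈ ℤ[X]` and `P.reverse = ± P`, then `α⁻¹` is a root too. -/
theorem inv_mem_roots_of_reverse_eq {P : ℤ[X]} {s : ℤ} (hrev : P.reverse = C s * P) (hs : s ≠ 0)
    {α : ℂ} (hα : α ∈ (P.map (Int.castRingHom ℂ)).roots) (hα0 : α ≠ 0) :
    α⁻¹ ∈ (P.map (Int.castRingHom ℂ)).roots := by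
  have hP0 : P.map (Int.castRingHom ℂ) ≠ 0 := (mem_roots'.mp hα).1
  have hroot : (P.map (Int.castRingHom ℂ)).eval α = 0 := (mem_roots hP0).mp hα
  haveI : Invertible α := invertibleOfNonzero hα0
  have h := eval₂_reverse_mul_pow (Int.castRingHom ℂ) α P
  rw [← eval_map, ← eval_map, hroot, invOf_eq_inv] at h
  -- `eval α⁻¹ (P.reverse.map) * α^d = 0`
  have h2 : (P.reverse.map (Int.castRingHom ℂ)).eval α⁻¹ = 0 := by
    rcases mul_eq_zero.mp h with h | h
    · exact h
    · exact absurd (pow_eq_zero_iff'.mp h).1 hα0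
  rw [hrev, Polynomial.map_mul, map_C, eval_mul, eval_C, eq_intCast, mul_eq_zero] at h2
  rcases h2 with h2 | h2
  · exact absurd (Int.cast_eq_zero.mp h2) hs
  · exact (mem_roots hP0).mpr h2

/-- **The Mahler measure of a Pisot polynomial is the Pisot number.** -/
theorem intMahlerMeasure_eq_of_pisot {P : ℤ[X]} (hmonic : P.Monic) (hirr : Irreducible P) {θ : ℝ}
    (hθ1 : 1 < θ) (hroot : ((θ : ℂ)) ∈ (P.map (Int.castRingHom ℂ)).roots)
    (hothers : ∀ α ∈ (P.map (Int.castRingHom ℂ)).roots, α ≠ (θ : ℂ) → ‖α‖ < 1) :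
    intMahlerMeasure P = θ := by
  have hinj : Function.Injective (Int.castRingHom ℂ) := (Int.castRingHom ℂ).injective_int
  have hP0 : P.map (Int.castRingHom ℂ) ≠ 0 := (mem_roots'.mp hroot).1
  have hdeg : 0 < P.natDegree := by
    by_contra h
    push Not at h
    have hc := eq_C_of_natDegree_eq_zero (Nat.le_zero.mp h)
    rw [hc, map_C, roots_C] at hroot
    exact Multiset.notMem_zero _ hroot
  have hnodup := nodup_roots_of_irreducible hirr hdeg
  have hM : intMahlerMeasure P = ‖(P.map (Int.castRingHom ℂ)).leadingCoeff‖ *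
      ((P.map (Int.castRingHom ℂ)).roots.map (fun α => max 1 ‖α‖)).prod :=
    mahlerMeasure_eq_leadingCoeff_mul_prod_roots _
  rw [hM, leadingCoeff_map_of_injective hinj, hmonic.leadingCoeff, map_one, norm_one, one_mul,
    ← Multiset.cons_erase hroot, Multiset.map_cons, Multiset.prod_cons]
  have hrest : (((P.map (Int.castRingHom ℂ)).roots.erase (θ : ℂ)).map (fun α => max 1 ‖α‖)).prod = 1 := by
    rw [Multiset.prod_eq_one]
    intro x hx
    rw [Multiset.mem_map] at hx
    obtain ⟨α, hα, rfl⟩ := hx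
    have hne : α ≠ (θ : ℂ) := ((hnodup.mem_erase_iff).mp hα).1
    exact max_eq_left (hothers α (Multiset.mem_of_mem_erase hα) hne).le
  rw [hrest, mul_one, Complex.norm_real, Real.norm_eq_abs, abs_of_pos (by linarith),
    max_eq_right hθ1.le]

/-- **Siegel's theorem (lower bound for Pisot numbers)** [Siegel 1944; McKee–Smyth §12.3]: if `θ > 1` is a
root of a monic irreducible `P ∈ ℤ[X]` all of whose other complex roots have modulus `< 1`, then
`θ ≥ θ₀ = 1.3247…` (the real root of `z³ = z + 1`, `= M(z³ - z - 1)`). -/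
theorem smythTheta_le_of_pisot {P : ℤ[X]} (hmonic : P.Monic) (hirr : Irreducible P) {θ : ℝ}
    (hθ1 : 1 < θ) (hroot : ((θ : ℂ)) ∈ (P.map (Int.castRingHom ℂ)).roots)
    (hothers : ∀ α ∈ (P.map (Int.castRingHom ℂ)).roots, α ≠ (θ : ℂ) → ‖α‖ < 1) :
    smythTheta ≤ θ := by
  have hinj : Function.Injective (Int.castRingHom ℂ) := (Int.castRingHom ℂ).injective_int
  have hP0 : P.map (Int.castRingHom ℂ) ≠ 0 := (mem_roots'.mp hroot).1
  have hθroot : (P.map (Int.castRingHom ℂ)).eval (θ : ℂ) = 0 := (mem_roots hP0).mp hroot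
  have hdeg : 0 < P.natDegree := by
    by_contra h
    push Not at h
    have hc := eq_C_of_natDegree_eq_zero (Nat.le_zero.mp h)
    rw [hc, map_C, roots_C] at hroot
    exact Multiset.notMem_zero _ hroot
  have hnodup := nodup_roots_of_irreducible hirr hdeg
  have hcard : Multiset.card (P.map (Int.castRingHom ℂ)).roots = P.natDegree := by
    have h := (IsAlgClosed.splits (P.map (Int.castRingHom ℂ))).natDegree_eq_card_roots
    rw [natDegree_map_eq_of_injective hinj] at h
    exact h.symm
  have hθlt : (13248 : ℝ) / 10000 < θ → smythTheta ≤ θ := fun h => (smythTheta_lt.trans h).le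
  have hMθ := intMahlerMeasure_eq_of_pisot hmonic hirr hθ1 hroot hothers
  -- `P(0) ≠ 0` unless `deg P = 1`
  rcases Nat.lt_or_ge P.natDegree 3 with hsmall | hbig
  · -- degrees 1 and 2: `θ ≥ (1+√5)/2 > θ₀` directly from `P(θ) = 0`
    -- real form of `P(θ) = 0`
    have hsum := hmonic.as_sum
    interval_cases hd : P.natDegree
    · -- degree 1: `θ = -P.coeff 0` is an integer `> 1`, hence `≥ 2`
      have hP : P = X + C (P.coeff 0) := by
        rw [Finset.sum_range_one, pow_zero, mul_one, pow_one] at hsum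
        exact hsum
      have hθZ : (θ : ℂ) = -((P.coeff 0 : ℤ) : ℂ) := by
        have h := hθroot
        rw [hP, Polynomial.map_add, map_X, map_C, eval_add, eval_X, eval_C, eq_intCast] at h
        linear_combination h
      have hθR : θ = -((P.coeff 0 : ℤ) : ℝ) := by exact_mod_cast hθZ
      apply hθlt
      have h2 : (2 : ℝ) ≤ θ := by
        rw [hθR] at hθ1 ⊢
        have : (1 : ℤ) < -P.coeff 0 := by exact_mod_cast hθ1
        have : (2 : ℤ) ≤ -P.coeff 0 := this
        exact_mod_cast this
      linarith
    · -- degree 2: `θ² + uθ + v = 0`, the other root `-u-θ` has modulus `< 1` (or equals `θ`)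
      set u : ℤ := P.coeff 1 with hu
      set v : ℤ := P.coeff 0 with hv
      have hP : P = X ^ 2 + C u * X + C v := by
        rw [Finset.sum_range_succ, Finset.sum_range_succ, Finset.sum_range_zero, zero_add, pow_zero,
          mul_one, pow_one] at hsum
        rw [hsum, hu, hv]
        ring
      have heq : ∀ z : ℂ, (P.map (Int.castRingHom ℂ)).eval z = z ^ 2 + u * z + v := by
        intro z
        rw [hP, Polynomial.map_add, Polynomial.map_add, Polynomial.map_pow, map_X, Polynomial.map_mul,
          map_C, map_X, map_C, eval_add, eval_add, eval_pow, eval_X, eval_mul, eval_C, eval_X, eval_C,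
          eq_intCast, eq_intCast]
      have hθeq : (θ : ℝ) ^ 2 + u * θ + v = 0 := by
        have h := hθroot
        rw [heq] at h
        exact_mod_cast h
      have hv0 : v ≠ 0 := by
        intro h0
        have := natDegree_eq_one_of_irreducible_coeff_zero hirr (by rw [← hv]; exact h0)
        omega
      -- the other root
      set θ' : ℝ := -u - θ with hθ'
      have hθ'root : ((θ' : ℝ) : ℂ) ∈ (P.map (Int.castRingHom ℂ)).roots := by
        rw [mem_roots hP0, IsRoot.def, heq]
        have : (θ' : ℝ) ^ 2 + u * θ' + v = 0 := by rw [hθ']; nlinarith [hθeq]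
        exact_mod_cast this
      by_cases hθθ : θ' = θ
      · -- double root: `P = (X + u/2)²` would be reducible
        exfalso
        have hu2 : (u : ℝ) = -2 * θ := by rw [hθ'] at hθθ; linarith
        have hv4 : 4 * v = u ^ 2 := by
          have : (4 : ℝ) * v = (u : ℝ) ^ 2 := by nlinarith [hθeq, hu2]
          exact_mod_cast this
        have hueven : Even u := by
          by_contra hodd
          rw [Int.not_even_iff_odd] at hodd
          obtain ⟨m, hm⟩ := hodd
          have : u ^ 2 = 4 * (m ^ 2 + m) + 1 := by rw [hm]; ring
          omega
        obtain ⟨w, hw⟩ := hueven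
        have hvw : v = w ^ 2 := by
          have h4 : 4 * v = 4 * w ^ 2 := by rw [hv4, hw]; ring
          linarith
        have hfac : P = (X + C w) * (X + C w) := by
          rw [hP, hvw, hw, map_add, map_pow]
          ring
        rcases hirr.isUnit_or_isUnit hfac with hunit | hunit <;>
        · have := natDegree_eq_zero_of_isUnit hunit
          rw [natDegree_X_add_C] at this
          exact one_ne_zero this
      · have hlt := hothers _ hθ'root (by exact_mod_cast hθθ)
        rw [Complex.norm_real, Real.norm_eq_abs, hθ'] at hlt
        -- `|u + θ| < 1`, `θ |u + θ| = |v| ≥ 1`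
        have hv1 : (1 : ℝ) ≤ |(v : ℝ)| := by exact_mod_cast Int.one_le_abs hv0
        have hvθ : (v : ℝ) = -θ * (θ + u) := by linarith [hθeq, sq θ]
        rw [hvθ, abs_mul, abs_neg, abs_of_pos (by linarith)] at hv1
        have hab : |(-u : ℝ) - θ| = |θ + u| := by
          rw [show (-(u : ℝ)) - θ = -(θ + u) by ring, abs_neg]
        rw [hab] at hlt
        -- integer case analysis on `u`
        have hu_lt : (u : ℝ) < 1 - θ := by
          rcases abs_lt.mp hlt with ⟨_, h2⟩; linarith
        have hu_gt : -1 - θ < (u : ℝ) := by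
          rcases abs_lt.mp hlt with ⟨h1, _⟩; linarith
        apply hθlt
        have huZ : u ≤ -1 := by
          have : (u : ℝ) < 0 := by linarith
          exact Int.le_sub_one_of_lt (by exact_mod_cast this)
        rcases lt_or_eq_of_le huZ with hlt1 | heq1
        · have huZ2 : u ≤ -2 := by omega
          rcases lt_or_eq_of_le huZ2 with hlt2 | heq2
          · have : (u : ℝ) ≤ -3 := by exact_mod_cast (show u ≤ -3 by omega)
            linarith
          · have hu2 : (u : ℝ) = -2 := by exact_mod_cast heq2
            rw [hu2] at hv1
            -- `θ |θ - 2| ≥ 1` with `1 < θ < 3` forces `θ ≥ 1 + √2 > 2.4`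
            rcases le_or_gt θ 2 with h2 | h2
            · rw [abs_of_nonpos (by linarith)] at hv1; nlinarith
            · rw [abs_of_pos (by linarith)] at hv1; nlinarith
        · have hu1 : (u : ℝ) = -1 := by exact_mod_cast heq1
          rw [hu1] at hv1
          rw [abs_of_pos (by linarith)] at hv1
          -- `θ (θ - 1) ≥ 1` ⇒ `θ ≥ φ > 1.6`
          nlinarith
  · -- degree ≥ 3: `P` is nonreciprocal, apply Smyth's theorem
    have h0 : P.coeff 0 ≠ 0 := by
      intro h
      have := natDegree_eq_one_of_irreducible_coeff_zero hirr h
      omega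
    have hθ0 : (θ : ℂ) ≠ 0 := by exact_mod_cast (show θ ≠ 0 by linarith)
    -- if `P.reverse = ± P`, a third root `α ∉ {θ, θ⁻¹}` has `|α| < 1` and `α⁻¹` is a root of modulus `> 1`
    have hnotrev : ∀ s : ℤ, s = 1 ∨ s = -1 → P.reverse ≠ C s * P := by
      intro s hs hrev
      have hs0 : s ≠ 0 := by rcases hs with h | h <;> simp [h]
      set R := (P.map (Int.castRingHom ℂ)).roots with hR
      have hθinv : (θ : ℂ)⁻¹ ∈ R := inv_mem_roots_of_reverse_eq hrev hs0 hroot hθ0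
      have hne1 : (θ : ℂ)⁻¹ ≠ θ := by
        intro h
        have h2 : (θ : ℝ)⁻¹ = θ := by exact_mod_cast h
        have : θ * θ = 1 := by field_simp at h2; nlinarith [h2]
        nlinarith
      -- a third root
      have hcard3 : 1 ≤ Multiset.card ((R.erase (θ : ℂ)).erase (θ : ℂ)⁻¹) := by
        have h1 : Multiset.card (R.erase (θ : ℂ)) = P.natDegree - 1 := by
          rw [Multiset.card_erase_of_mem hroot, hcard]; rfl
        have hmem : (θ : ℂ)⁻¹ ∈ R.erase (θ : ℂ) := (hnodup.mem_erase_iff).mpr ⟨hne1, hθinv⟩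
        have h2 : Multiset.card ((R.erase (θ : ℂ)).erase (θ : ℂ)⁻¹) = P.natDegree - 1 - 1 := by
          rw [Multiset.card_erase_of_mem hmem, h1]; rfl
        omega
      obtain ⟨α, hα⟩ := Multiset.card_pos_iff_exists_mem.mp (by omega :
        0 < Multiset.card ((R.erase (θ : ℂ)).erase (θ : ℂ)⁻¹))
      have hnodup1 : (R.erase (θ : ℂ)).Nodup := hnodup.erase _
      have hα1 : α ≠ (θ : ℂ)⁻¹ ∧ α ∈ R.erase (θ : ℂ) := (hnodup1.mem_erase_iff).mp hα
      have hα2 : α ≠ (θ : ℂ) ∧ α ∈ R := (hnodup.mem_erase_iff).mp hα1.2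
      have hαlt : ‖α‖ < 1 := hothers α hα2.2 hα2.1
      have hα0 : α ≠ 0 := by
        intro h
        rw [h] at hα2
        have := (mem_roots hP0).mp hα2.2
        rw [IsRoot.def, eval_map, eval₂_at_zero, eq_intCast, Int.cast_eq_zero] at this
        exact h0 this
      have hαinv : α⁻¹ ∈ R := inv_mem_roots_of_reverse_eq hrev hs0 hα2.2 hα0
      have hαinv_ne : α⁻¹ ≠ (θ : ℂ) := by
        intro h
        apply hα1.1
        rw [← h, inv_inv]
      have hlt2 := hothers _ hαinv hαinv_ne
      rw [norm_inv] at hlt2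
      have hpos : 0 < ‖α‖ := norm_pos_iff.mpr hα0
      have : 1 < ‖α‖⁻¹ := one_lt_inv_iff₀.mpr ⟨hpos, hαlt⟩
      linarith
    have h1 : P.reverse ≠ P := by
      have := hnotrev 1 (Or.inl rfl); rwa [map_one, one_mul] at this
    have h2 : P.reverse ≠ -P := by
      have := hnotrev (-1) (Or.inr rfl); rwa [map_neg, map_one, neg_one_mul] at this
    rw [← hMθ]
    exact intMahlerMeasure_ge_smythTheta_of_nonreciprocal h0 h1 h2

end Summit.Ventures.DiscreteObjects.Mahler
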